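import Summits.ResolutionOfSingularities.ResolutionOfSingularities.Theorems.WeightedInvariantDatumToEmbeddedCentreHomogeneousCoaction
import HarnessLib

/-!
# (hom) for all chart gradings of the orbit centre — the generic torus point: its prime, its dimension, and the
# torus-generic base change square `Spec (A[ℤʲ]_S) → Spec A` over `Spec k(ℤʲ) → Spec k`

Route `ResolutionOfSingularities/WeightedInvariant`, door crux `HypersurfaceCentreConstruction`
(stmt-ResolutionOfSingularities-19897) — OURS, helper; e-ladder rung `e = 1`, registered stub `stub_e1_centre` of
`res-L1-w43-stub-10`, item **(L3)** of `D/res-D-pv-025/DOOR-ELADDER-PLAN.md` §7 (res-type-047).  Companion of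
`…OrbitCentreHomogeneousKernel.lean` (the fact-free kernel) and `…OrbitCentreHomogeneous.lean` (the discharge from
Abramovich–Quek–Schober's separable base change and the scheme-level closer).  This file supplies the SQUARE along
which the separable-base-change clause is read "at the generic point of `T × 𝒬`" (AQS §5: "`k(t₁, …, t_m)`"):

* §5 `map_singleZeroRingHom_eq_ker`, `isPrime_map_singleZeroRingHom`, `comap_map_singleZeroRingHom` — the prime
  `P · A[M]` of `A[M]` (`M` with unique sums) over a prime `P` of `A`; `ringKrullDim_eq_of_isLocalization_atPrime_map`
  — for `A` Noetherian and `M = ℤʲ`, every localization of `A[M]` at `P · A[M]` has the Krull dimension of `A_P`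
  (`ht(P · A[M]) = ht P`: flat going-down, Mathlib's `Ideal.height_eq_height_add_of_liesOver_of_hasGoingDown`, the
  fibre `(A ⧸ P)[M]` being a domain);
* §6 `formallySmooth_fractionRing_addMonoidAlgebra` — `k(ℤʲ) = Frac k[ℤʲ]` is formally smooth (separable) over `k`;
  `isPushout_fractionRing_localization` — the square `k → A`, `k → k(ℤʲ)`, `A → A[ℤʲ]_S`, `k(ℤʲ) → A[ℤʲ]_S`
  (`S` = non-zero elements of `k[ℤʲ]`) is a pushout in `CommRingCat` (`AddMonoidAlgebra.instIsPushout` +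
  `Algebra.isPushout_of_isLocalization`), i.e. `Spec (A[ℤʲ]_S) = Spec A ×_k Spec k(ℤʲ)`
  (`isPullback_SpecMap_of_isPushout`); `disjoint_algebraMapSubmonoid_map_singleZeroRingHom` — `S` misses `P · A[ℤʲ]`,
  so `P · A[ℤʲ]` survives in `A[ℤʲ]_S` as the point `η′` over `P`.

Mathlib plumbing only; no facts, no definitions, no gradings.  Nothing here is a claim about Hironaka's problem or
about any manuscript under adjudication; AI-written, weaker than expert review.
-/

noncomputable section

set_option linter.dupNamespace false -- mandated namespace of this single-conjunct summit

namespace Summit.ResolutionOfSingularities.ResolutionOfSingularities.Theorems.OrbitCentreHomogeneous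

open AddMonoidAlgebra DatumToEmbedded.CentreHomogeneous IsLocalRing CategoryTheory AlgebraicGeometry
open scoped AlgebraMonoidAlgebra nonZeroDivisors

/-! ## §5 The prime `P · A[M]` of the generic torus point: primality, contraction, dimension -/

section GenericPoint

variable {M A : Type*} [AddCommGroup M] [CommRing A] (P : Ideal A)

/-- `P · A[M]` is the kernel of `A[M] → (A ⧸ P)[M]`. [folklore] -/
theorem map_singleZeroRingHom_eq_ker :
    P.map (singleZeroRingHom : A →+* A[M]) = RingHom.ker (mapRingHom M (Ideal.Quotient.mk P)) := by
  classical
  ext z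
  rw [RingHom.mem_ker, AddMonoidAlgebra.ext_iff, Finsupp.ext_iff]
  simp only [coeff_mapRingHom, coeff_zero, Finsupp.coe_zero, Pi.zero_apply,
    Ideal.Quotient.eq_zero_iff_mem]
  exact ⟨fun hz m => coeff_mem_of_mem_map hz m, fun h => mem_map_of_coeff_mem h⟩

/-- `P · A[M]` is prime for `P` prime (`M` with unique sums): `(A ⧸ P)[M]` is a domain. [folklore] -/
theorem isPrime_map_singleZeroRingHom [UniqueSums M] [P.IsPrime] :
    (P.map (singleZeroRingHom : A →+* A[M])).IsPrime := by
  rw [map_singleZeroRingHom_eq_ker]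
  exact RingHom.ker_isPrime _

/-- `A ∩ P · A[M] = P`. [folklore] -/
theorem comap_map_singleZeroRingHom :
    (P.map (singleZeroRingHom : A →+* A[M])).comap singleZeroRingHom = P := by
  classical
  ext a
  rw [Ideal.mem_comap]
  constructor
  · intro h
    simpa [singleZeroRingHom_eq, coeff_single] using coeff_mem_of_mem_map h 0
  · exact fun h => Ideal.mem_map_of_mem _ h

/-- **The local ring at the generic torus point has the dimension of `A_P`**: for `A` Noetherian, any
localization of `A[M]` (`M = ℤʲ`) at `P · A[M]` has the Krull dimension of any localization of `A` at `P` —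
`ht(P · A[M]) = ht(P)` by flat going-down, the fibre `(A ⧸ P)[M]` of `P · A[M]` being of height `0`. [folklore] -/
theorem ringKrullDim_eq_of_isLocalization_atPrime_map {j : ℕ} [IsNoetherianRing A] [P.IsPrime]
    (O : Type*) [CommRing O] [Algebra A O] [IsLocalization.AtPrime O P]
    (𝔓 : Ideal A[Fin j → ℤ]) [𝔓.IsPrime] (h𝔓 : 𝔓 = P.map (singleZeroRingHom : A →+* A[Fin j → ℤ]))
    (B : Type*) [CommRing B] [Algebra A[Fin j → ℤ] B] [IsLocalization.AtPrime B 𝔓] :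
    ringKrullDim B = ringKrullDim O := by
  haveI : IsNoetherianRing A[Fin j → ℤ] := Algebra.FiniteType.isNoetherianRing A _
  rw [IsLocalization.AtPrime.ringKrullDim_eq_height 𝔓 B, IsLocalization.AtPrime.ringKrullDim_eq_height P O]
  haveI : 𝔓.LiesOver P := ⟨by
    rw [Ideal.under_def, h𝔓]
    exact (comap_map_singleZeroRingHom P).symm⟩
  rw [Ideal.height_eq_height_add_of_liesOver_of_hasGoingDown P 𝔓]
  have h0 : (𝔓.map (Ideal.Quotient.mk (P.map (algebraMap A A[Fin j → ℤ])))).height = 0 := by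
    have hPA : P.map (algebraMap A A[Fin j → ℤ]) = 𝔓 := by rw [h𝔓]; rfl
    rw [hPA, Ideal.map_quotient_self]
    haveI : IsDomain (A[Fin j → ℤ] ⧸ 𝔓) := Ideal.Quotient.isDomain 𝔓
    exact Ideal.height_bot
  rw [h0, add_zero]

end GenericPoint

/-! ## §6 The torus-generic base change square `Spec (A ⊗ₖ k(ℤʲ)) → Spec A` over `Spec k(ℤʲ) → Spec k` -/

section Square

variable (k : Type) [Field k] (j : ℕ) (A : Type) [CommRing A] [Algebra k A]

/-- `k(t₁^{±1}, …, t_j^{±1}) = Frac k[ℤʲ]` is formally smooth over `k` (separably generated). [folklore] -/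
theorem formallySmooth_fractionRing_addMonoidAlgebra :
    Algebra.FormallySmooth k (FractionRing k[Fin j → ℤ]) := by
  haveI : Algebra.Smooth k k[Fin j → ℤ] := smooth_addMonoidAlgebra_pi k j
  infer_instance

/-- The tower `k → k(ℤʲ) → A[ℤʲ]_S` (`S` = non-zero elements of `k[ℤʲ]`). [folklore] -/
theorem isScalarTower_fractionRing_localization :
    IsScalarTower k (FractionRing k[Fin j → ℤ])
      (Localization (Algebra.algebraMapSubmonoid A[Fin j → ℤ] (k[Fin j → ℤ])⁰)) := by
  refine IsScalarTower.of_algebraMap_eq' ?_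
  rw [IsScalarTower.algebraMap_eq k A[Fin j → ℤ] (Localization _),
    IsScalarTower.algebraMap_eq k k[Fin j → ℤ] A[Fin j → ℤ], ← RingHom.comp_assoc,
    ← IsScalarTower.algebraMap_eq k[Fin j → ℤ] A[Fin j → ℤ] (Localization _),
    IsScalarTower.algebraMap_eq k[Fin j → ℤ] (FractionRing k[Fin j → ℤ]) (Localization _),
    RingHom.comp_assoc, ← IsScalarTower.algebraMap_eq k k[Fin j → ℤ] (FractionRing k[Fin j → ℤ])]

/-- **The torus-generic base change is a pushout** (in `CommRingCat`, in the shape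
`isPullback_SpecMap_of_isPushout` consumes): `A → A[ℤʲ]_S ← k(ℤʲ)` is the pushout of `A ← k → k(ℤʲ)` —
`A[ℤʲ] = A ⊗ₖ k[ℤʲ]` (`AddMonoidAlgebra.instIsPushout`) and localization is base change
(`Algebra.isPushout_of_isLocalization`). [folklore] -/
theorem isPushout_fractionRing_localization :
    IsPushout (CommRingCat.ofHom (algebraMap k A))
      (CommRingCat.ofHom (algebraMap k (FractionRing k[Fin j → ℤ])))
      (CommRingCat.ofHom (algebraMap A (Localization (Algebra.algebraMapSubmonoid A[Fin j → ℤ] (k[Fin j → ℤ])⁰))))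
      (CommRingCat.ofHom (algebraMap (FractionRing k[Fin j → ℤ])
        (Localization (Algebra.algebraMapSubmonoid A[Fin j → ℤ] (k[Fin j → ℤ])⁰)))) := by
  haveI := isScalarTower_fractionRing_localization k j A
  haveI : Algebra.IsPushout k[Fin j → ℤ] (FractionRing k[Fin j → ℤ]) A[Fin j → ℤ]
      (Localization (Algebra.algebraMapSubmonoid A[Fin j → ℤ] (k[Fin j → ℤ])⁰)) :=
    (Algebra.isPushout_of_isLocalization ((k[Fin j → ℤ])⁰) (FractionRing k[Fin j → ℤ]) A[Fin j → ℤ]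
      (Localization (Algebra.algebraMapSubmonoid A[Fin j → ℤ] (k[Fin j → ℤ])⁰))).symm
  have h : Algebra.IsPushout k (FractionRing k[Fin j → ℤ]) A
      (Localization (Algebra.algebraMapSubmonoid A[Fin j → ℤ] (k[Fin j → ℤ])⁰)) :=
    (Algebra.IsPushout.comp_iff k k[Fin j → ℤ] A A[Fin j → ℤ]).mpr inferInstance
  exact CommRingCat.isPushout_iff_isPushout.mpr h.symm

/-- The multiplicative set `S` (non-zero elements of `k[ℤʲ]`) misses `P · A[ℤʲ]` for every proper `P`: an element
of `k[ℤʲ]` with all coefficients in `P` (after `k → A`) is zero. [folklore] -/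
theorem disjoint_algebraMapSubmonoid_map_singleZeroRingHom (P : Ideal A) (hP : P ≠ ⊤) :
    Disjoint ((Algebra.algebraMapSubmonoid A[Fin j → ℤ] (k[Fin j → ℤ])⁰ : Submonoid A[Fin j → ℤ]) : Set A[Fin j → ℤ])
      (P.map (singleZeroRingHom : A →+* A[Fin j → ℤ]) : Set A[Fin j → ℤ]) := by
  classical
  rw [Set.disjoint_left]
  rintro _ ⟨q, hq, rfl⟩ hmem
  have hq0 : q ≠ 0 := nonZeroDivisors.ne_zero hq
  apply hq0
  ext m
  have hc := coeff_mem_of_mem_map hmem m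
  change (mapRingHom (Fin j → ℤ) (algebraMap k A) q).coeff m ∈ P at hc
  rw [coeff_mapRingHom] at hc
  by_contra hne
  have hu : IsUnit (algebraMap k A (q.coeff m)) := (IsUnit.mk0 _ hne).map _
  exact hP (Ideal.eq_top_of_isUnit_mem P hc hu)

end Square


end Summit.ResolutionOfSingularities.ResolutionOfSingularities.Theorems.OrbitCentreHomogeneous

end
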